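import Summits.CriticalPhenomena.SAWScalingLimit.Theses.SAWExcursionCardy
import Summits.CriticalPhenomena.SAWScalingLimit.Theorems.SAWRenewalTightnessEventualTightSplit
import Summits.CriticalPhenomena.SAWScalingLimit.Theorems.SAWRenewalTightnessEventualTightVirginization
import Summits.CriticalPhenomena.SAWScalingLimit.Theorems.SAWRenewalTightnessEventualTightAspectReduction
import HarnessLib

/-!
# Split glue for the along-the-mesh tightness crux `SAWExcursionCardy.EventualTight` (stmt-CriticalPhenomena-1881)

Crux-strategist file (seat `planner-cstrat-stmt-CriticalPhenomena-1881-s1-0`, 2026-08-17).  The crux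

  `SAWExcursionCardy.EventualTight :
     ∀ D a b, SAW.IsEndpointApprox D a b → IsTightAlongMesh (fun δ γ ↦ γ.curve) (fun δ ↦ SAW.law D.carrier δ (a δ) (b δ))`

(eventual tightness on `CurveClass ℂ` of the critical `δℤ²` SAW laws of a Dobrushin domain, the
precompactness half of route `SAWExcursionCardy`'s Prokhorov assembly; shared verbatim by nine
routes) is the along-the-mesh twin of the set-form crux `SAWRenewalTightness.EventualTight`
(stmt-1372, `∃ δ₀ > 0, IsTightMeasureSet …`), which route `SAWRenewalTightness` rev 2 SPLIT into
`ConfinementPositivity` (stmt-17587) and `BulkShellTight` (stmt-17588) with the landed glue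
`Theorems.EventualTight_of_subs` (this directory, `…EventualTightSplit.lean`).  Since then the bulk
child has been VIRGINIZED by landed theorems of line `Sketch` v7 (lead c4):
`bulkShellTightAtAspectTwo_of_virginArcTraversalTight` (`…EventualTightVirginization.lean`: the pure
lattice atom X2c₁ gives per-shell traversal-count tightness on interior shells of aspect two) and
`stub_aspectReduction` (`…EventualTightAspectReduction.lean`: aspect two gives every interior shell).

This file records, sorry-free, the three compositions the strategist's DECOMPOSITION of stmt-1881 uses:

* `EventualTight_of_setForm` — the bridge stmt-1372 ⇒ stmt-1881
  (`isTightAlongMesh_of_isTightMeasureSet_image`; the SAW observable is measurable at every mesh);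
* `EventualTight_of_children` — `ConfinementPositivity → BulkShellTight → SAWExcursionCardy.EventualTight`
  (the twin's split, concluded at the along-the-mesh form; the FALLBACK split of stmt-1881);
* `EventualTight_of_subs` — `ConfinementPositivity → VirginArcTraversalTight (X2c₁) → SAWExcursionCardy.EventualTight`,
  the glue of the FILED split of stmt-1881: restriction positivity for nested Dobrushin domains with
  common marked-point sockets, plus the exterior-uniform virgin-disc traversal atom of the critical
  `ℤ²` SAW (Kemppainen–Smirnov Condition G2 for the `x_c`-arc measure of a virgin lattice disc at ONE
  annulus shape `D(z₀; 2N/5, 3N/5)`, uniform over everything outside the disc), imply the crux.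

Hypotheses are written as the BODIES of the route defs (verbatim the registered stub signatures
`stub_confinementPositivity`, `stub_virginArcTraversalTight` of stmt-1372's skeleton v7 and the body of
`SAWRenewalTightness.BulkShellTight`), so that the glue items of the split type-check by unfolding.
-/

noncomputable section

open MeasureTheory Filter Topology Set Metric
open scoped ENNReal NNReal unitInterval
open Literature.Probability.RandomPlanarGeometry Literature.Probability.LatticeModels

namespace Summit.CriticalPhenomena.SAWScalingLimit.Theorems.SAWExcursionCardySplit

/-- **Bridge stmt-1372 ⇒ stmt-1881.** Set-level tightness of the push-forward SAW laws on an initial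
mesh interval gives tightness along the mesh filter `𝓝[>] 0` (the SAW observable `γ ↦ γ.curve` is
measurable for the discrete σ-algebra at every mesh). [folklore] -/
theorem EventualTight_of_setForm
    (h : Summit.CriticalPhenomena.SAWScalingLimit.Theses.SAWRenewalTightness.EventualTight) :
    Summit.CriticalPhenomena.SAWScalingLimit.Theses.SAWExcursionCardy.EventualTight := by
  intro D a b hab
  obtain ⟨δ₀, hδ₀, hT⟩ := h D a b hab
  exact isTightAlongMesh_of_isTightMeasureSet_image
    (Eventually.of_forall fun δ => SAW.aemeasurable_curve D.carrier δ (a δ) (b δ)) hδ₀ hT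

/-- **Fallback split glue (the twin's children, concluded at stmt-1881):**
`ConfinementPositivity → BulkShellTight → SAWExcursionCardy.EventualTight`, by the landed
`Theorems.EventualTight_of_subs` (Aizenman–Burchard criterion through `TightOfShellCrossing_proof` and
the socketed-enlargement split `ShellCrossingBound_of_subs`) and the bridge.
[cite: AizenmanBurchardDuke1999, Thms 1.1-1.2 and Lemma 3.1] -/
theorem EventualTight_of_children
    (hE : ∀ (D D' : DobrushinDomain) (a b : ℝ → Site 2) (d : ℝ), 0 < d →
      D'.carrier ⊆ D.carrier → D'.pt 0 = D.pt 0 → D'.pt 1 = D.pt 1 →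
      D.carrier ∩ (Metric.ball (D.pt 0) d ∪ Metric.ball (D.pt 1) d) ⊆ D'.carrier →
      SAW.IsEndpointApprox D' a b →
        ∃ c δ₀ : ℝ, 0 < c ∧ 0 < δ₀ ∧ ∀ δ ∈ Set.Ioc (0 : ℝ) δ₀,
          ENNReal.ofReal c ≤ SAW.law D.carrier δ (a δ) (b δ)
            {γ | ∃ γ' : SAW.DomainSAW D'.carrier δ (a δ) (b δ),
              γ'.walk.support = γ.walk.support})
    (hB : ∀ (D : DobrushinDomain) (a b : ℝ → Site 2), SAW.IsEndpointApprox D a b →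
      ∀ (y : ℂ) (η R : ℝ), 0 < η → η < R → Metric.closedBall y (2 * R) ⊆ D.carrier →
        ∀ ε : ℝ, 0 < ε → ∃ (j : ℕ) (δ₁ : ℝ), 0 < δ₁ ∧ ∀ δ ∈ Set.Ioc (0 : ℝ) δ₁,
          SAW.law D.carrier δ (a δ) (b δ)
            {γ | (⟨γ.walk.toCurve (meshPoint δ)⟩ : Curve ℂ).HasTraversals j y η R} ≤
            ENNReal.ofReal ε) :
    Summit.CriticalPhenomena.SAWScalingLimit.Theses.SAWExcursionCardy.EventualTight :=
  EventualTight_of_setForm (Theorems.EventualTight_of_subs hE hB)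

/-- **Filed split glue `EventualTight_of_subs` of stmt-CriticalPhenomena-1881:**
`ConfinementPositivity → VirginArcTraversalTight → SAWExcursionCardy.EventualTight`.  Restriction
positivity (the SAW box-crossing lower bound, shared item stmt-17587) and the virgin-disc traversal
atom X2c₁ of the critical `ℤ²` SAW (one annulus shape, uniform over exteriors and door pairs) imply
eventual tightness along the mesh: X2c₁ gives bulk shell tightness at aspect two by the landed
two-sided domain-Markov virginization (`bulkShellTightAtAspectTwo_of_virginArcTraversalTight`), every
interior shell by the landed aspect reduction (`stub_aspectReduction`), then the twin's split glue and
the bridge. [cite: AizenmanBurchardDuke1999, Thms 1.1-1.2 and Lemma 3.1; KemppainenSmirnov2017, Thm 1.5] -/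
theorem EventualTight_of_subs
    (hE : ∀ (D D' : DobrushinDomain) (a b : ℝ → Site 2) (d : ℝ), 0 < d →
      D'.carrier ⊆ D.carrier → D'.pt 0 = D.pt 0 → D'.pt 1 = D.pt 1 →
      D.carrier ∩ (Metric.ball (D.pt 0) d ∪ Metric.ball (D.pt 1) d) ⊆ D'.carrier →
      SAW.IsEndpointApprox D' a b →
        ∃ c δ₀ : ℝ, 0 < c ∧ 0 < δ₀ ∧ ∀ δ ∈ Set.Ioc (0 : ℝ) δ₀,
          ENNReal.ofReal c ≤ SAW.law D.carrier δ (a δ) (b δ)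
            {γ | ∃ γ' : SAW.DomainSAW D'.carrier δ (a δ) (b δ),
              γ'.walk.support = γ.walk.support})
    (hX : ∀ θ : ℝ, 0 < θ →
      ∃ (k : ℕ) (N₀ : ℝ), 0 < N₀ ∧
        ∀ (H : SimpleGraph (Site 2)) (Λ : Set (Site 2)) (z₀ : ℂ) (N : ℝ) (u c u' c' : Site 2),
          N₀ ≤ N →
          (H ≤ zdGraph 2 ∧ (∀ v : Site 2, dist (Site.toComplex v) z₀ ≤ N → v ∈ Λ) ∧
            ∀ v v' : Site 2, dist (Site.toComplex v) z₀ ≤ N + 1 →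
              dist (Site.toComplex v') z₀ ≤ N + 1 → (zdGraph 2).Adj v v' → H.Adj v v') →
          (H.Adj u c ∧ u ∉ Λ ∧ c ∈ Λ ∧ dist (Site.toComplex c) z₀ ≤ N ∧
            N < dist (Site.toComplex u) z₀) →
          (H.Adj u' c' ∧ u' ∉ Λ ∧ c' ∈ Λ ∧ dist (Site.toComplex c') z₀ ≤ N ∧
            N < dist (Site.toComplex u') z₀) →
          ∑' p : {p : {p : H.Walk c c' // p.IsPath ∧ ∀ v ∈ p.support, v ∈ Λ} //
              ∃ ι κ : Fin k → Fin (p.1.support.map Site.toComplex).length, (∀ m, ι m ≤ κ m) ∧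
                (∀ m, (dist ((p.1.support.map Site.toComplex).get (ι m)) z₀ ≤ 2 * N / 5 ∧
                    3 * N / 5 ≤ dist ((p.1.support.map Site.toComplex).get (κ m)) z₀) ∨
                  (3 * N / 5 ≤ dist ((p.1.support.map Site.toComplex).get (ι m)) z₀ ∧
                    dist ((p.1.support.map Site.toComplex).get (κ m)) z₀ ≤ 2 * N / 5)) ∧
                ∀ ⦃m m'⦄, m < m' → κ m ≤ ι m'},
              ENNReal.ofReal (SAW.criticalFugacity ^ p.1.1.length) ≤
            ENNReal.ofReal θ *
              ∑' p : {p : H.Walk c c' // p.IsPath ∧ ∀ v ∈ p.support, v ∈ Λ},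
                ENNReal.ofReal (SAW.criticalFugacity ^ p.1.length)) :
    Summit.CriticalPhenomena.SAWScalingLimit.Theses.SAWExcursionCardy.EventualTight :=
  EventualTight_of_children hE
    (stub_aspectReduction (bulkShellTightAtAspectTwo_of_virginArcTraversalTight hX))

end Summit.CriticalPhenomena.SAWScalingLimit.Theorems.SAWExcursionCardySplit

end
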